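import Literature.MathematicalPhysics.QuantumFieldTheory.Balaban1983to89.B6SectCTwoScaleV1
import Literature.MathematicalPhysics.QuantumFieldTheory.Balaban1983to89.B5Eq147TorusBridge

/-!
# `Balaban1983to89.B6ProjR212TorusBridge` — T. Bałaban, *Propagators and renormalization transformations for lattice gauge
# theories. II*, Commun. Math. Phys. **96** (1984) 223–250 [Balaban1984PropagatorsII], (2.10)–(2.12) p. 225: *"let R be an
# orthogonal projection in the space L²(T_η) onto the subspace ΔN(Q′)"* — ONE-LEVEL BRIDGE: p21's concrete V1 projection
# `B6SectAOperatorsV1.RE D c` IS the [Balaban1984PropagatorsI] p. 25 / (1.69) projection `R = B5Identities197Torus.RT` (= `1 − P − P_const`,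
# `P` of (1.70)) on the B5 owner's typed torus `T_η = Tor (fine (L^j) (Mk P j))`, through the tower projection `B5Eq147Landau.Rproj`

statement-level skeleton of published theorems with citation tags; proofs where landed; nothing here is a claim about the Yang–Mills mass gap

PDF held: `paper:balaban1984-cmp96-propagators-rt-ii` (journal page = PDF page + 222; p. 225 [PDF 3]) and
`paper:balaban1984-cmp95-propagators-rt-i` ([B5] = [Balaban1984PropagatorsI]; journal page = PDF page + 16; p. 25 [PDF 9], pp. 29–30
[PDF 13–14]); renders `run/shared/lean/pub/pub-balaban/b2b-balaban-ref1/pages/1984-cmp96-propagators-rt-II/…-p003-x2.png` read by this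
seat (gen 1, F1/F4 check of Sect. A).

PRINT (verbatim).  [B6] p. 225: *"Let us define N(Q′) = {λ: λ satisfies (2.7)}, (2.10) and let R be an orthogonal projection in the
space L²(T_η) onto the subspace ΔN(Q′). … R∂*A = 0. (2.12)"*; p. 224: *"we admit the case when some domains Ω_j are equal to T_η"*.
[B5] p. 25: *"The projection operator R has a clear meaning. It is an orthogonal projection on the linear subspace ΔN(Q′_k) of
L²(T_η), N(Q′_k) = {λ: Q′_kλ = 0}. Indeed RΔλ = Δλ if Q′_kλ = 0, and if Rω = ω then … ω = Δλ and Q′_kλ = 0"*; pp. 29–30: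
*"⟨A, Δ_aA⟩ = ⟨A, ∂*∂A⟩ + ⟨A, ∂R∂*A⟩ + a⟨A, Q*QA⟩ … (1.69) Δ = ∂*∂ + ∂∂*, R = I − P, … The configuration ∂*A is orthogonal to
constant functions and on such configurations the operator P is given by the formula P = Δ⁻¹Q′*(Q′Δ⁻²Q′*)⁻¹Q′Δ⁻¹. (1.70)"*.

CITATION HEADER (lean-in-tree rule) — WHAT IS REPRODUCED.  Phase-2 file of the `lit-balaban` typed skeleton (HOME
`run/shared/lean/pub/lit-balaban/`), seat **r03 gen 10** (B6 fold owner; own lane, free-target protocol G.5-34(d), TAKING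
2026-08-21T22:05Z), file (A) of the programme «one-level OPERATOR bridge V1 `G = GE` ↔ [B5] `Δ_a⁻¹`» towards row **B6.Prop2.5**;
rows touched (cells only): **B6.Eq2.12** (decls of record `B6SectA.*`, p21 `B6SectAOperatorsV1.RE` — untouched) as the ONE-LEVEL case
of **B5** p. 25 / (1.69)–(1.70) (decls of record r02 `B5Value126.PcT`, p21 `B5Identities197Torus.RT` — untouched).  THREE carriers, all
in the tree: (V1) p21's `ScalarSpace P = ℓ²(Site P 0)` with `RE D c = (ΔN(Q′_D)).starProjection` for a domain structure `D : Domains P`;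
(TW) the B5 owner's tower `Scl (towerM L (Mk P j) j)` with p16's `B5Eq147Landau.Rproj = (Δ N(Q′_j)).starProjection`; (FN) r02's typed torus
`Tor (fine (L^j) (Mk P j)) → ℂ` with the MATRIX `RT (L^j) (Mk P j) = 1 − PcT − Pker`.  Transports BY NAME: p16's `B5Eq117TorusCarriers.tS`
(V1 → TW; dictionaries `Lap_tS`, `Qsk_tS`, `inner_tS` of `B5Eq147TorusBridge`/`B5Eq117TorusCarriers`), p21's `B5TowerOneStroke.trS (towerE …) ∘ cplxS`
(TW → FN; dictionaries `LapS_towerE`, `QsOp_trS_eq_zero_iff`, `star_trS_dotProduct_trS`, `reS`/`imS` of p16's `B5HkOpLandauMin`), and p21's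
fixed-space theorems `RT_mulVec_LapS_of_ker` / `RT_mulVec_eq_LapS` for `RT`.  THEOREMS ONLY (no definition, no `def … : Prop`).

WHAT IS PROVED (kernel-checked, 0 sorry, standard axioms; every `d ≥ 1`, odd `L > 1` of `Params`, `j ≤ m + K`).
* §1 (TW → FN) **`trS_Rproj`**: `trS (towerE) (cplxS (Rproj j ω)) = RT (L^j) (Mk P j) *ᵥ trS (towerE) (cplxS ω)` for EVERY real tower
  function `ω` — the tower's orthogonal projection onto `ΔN(Q′_j)` IS the matrix `RT` (two-step characterisation: `RT` fixes the image,
  which lies in `ΔN(Q′_j)`; `RT` kills `ω − Rproj ω`, which is orthogonal to `ΔN(Q′_j)`, complex test functions split into real and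
  imaginary parts).
* §2 (V1 → TW) **`tS_RE`**: for every `D : Domains P` whose site constraints are EXACTLY `Q′_jλ = 0` on all of `T^{(j)}` (`hD`) and every
  lattice factor `c ≠ 0`: `tS (RE D c f) = Rproj j (tS f)`; instances `QpE_twoScale_empty_eq_zero_iff` (the two-scale structure of
  Sect. C at `Λ′ = ∅`, p22's `B6SectCTwoScaleV1.twoScale j hj ∅` — the ONE-LEVEL member of (2.90)) and `tS_RE_twoScale_empty`.
* §3 (V1 → FN) **`RE_bridge`** / **`RE_bridge_twoScale_empty`**: the composite, `R` of (2.12) read on r02's torus is `RT`.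
HONEST SCOPE.  One level only (all domains `Ω_i = T_η`): the multi-level `R` of (2.10)–(2.12) (constraints on several scales) has no
counterpart in [B5]; the identification is exact (no constants); `RE` vanishes on constants, as does `RT` (the tree's reading of
«R = I − P» off `1^⊥`, `B5Identities197Torus` §«ON R»).  Value = the `R`-piece of the one-level operator identification `Δ_a^{V1} = Δ_a^{[B5]}`
(file (B) of the programme), NOT summit progress.
-/

noncomputable section

open scoped BigOperators InnerProductSpace Matrix ComplexConjugate

namespace Literature.MathematicalPhysics.QuantumFieldTheory.Balaban1983to89.B6ProjR212TorusBridge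

open LatticeFieldCalculus B6SectADomainsV1 B6SectAOperatorsV1 B6SectCTwoScaleV1
open B5SectBStatements (Fld Scl cplx cplxS towerM Qsk)
open B5Eq147Landau (Lap lapResid Rproj mem_lapResid_iff)
open B5TowerOneStroke (towerE trS trS_apply' reC reC_apply)
open B5HkOpLandauMin (LapS_towerE QsOp_trS_eq_zero_iff star_trS_dotProduct_trS star_cplxS_dotProduct_cplxS
  star_dotProduct_RT_mulVec reS imS trS_reS trS_imS QsOp_mulVec_reC QsOp_mulVec_imC imC reC_add_imC)
open B5Eq117TorusCarriers (Mk tS tS_apply tSc tSc_apply Qsk_tS)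
open B5Eq147TorusBridge (Lap_tS inner_tS laplace_eq_smul)
open B5Prop11Plancherel (Tor fine)
open B5Block118 (QsOp)
open B5Action121 (LapS)
open B5Identities197Torus (RT RT_mulVec_LapS_of_ker RT_mulVec_eq_LapS)
open Matrix

/-! ## §1  TW → FN: the tower projection `Rproj` read on `T_η` is the matrix `RT` -/

section TowerToTorus

variable {d : ℕ} (L : ℕ) (M : Fin d → ℕ) [NeZero L] [hM : ∀ μ, NeZero (M μ)]

omit [NeZero L] hM in
/-- `trS ∘ cplxS` is additive-subtractive (bookkeeping). [cite: Balaban1984PropagatorsI, (1.20) p.20] -/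
theorem trS_cplxS_sub {N N' : Fin d → ℕ} (e : Tor N ≃ Tor N') (a b : Scl N) :
    trS e (cplxS (a - b)) = trS e (cplxS a) - trS e (cplxS b) := by
  funext x
  simp only [trS_apply', cplxS, Pi.sub_apply, PiLp.sub_apply, Complex.ofReal_sub]

/-- **orthogonality across the carriers**: if the real tower function `ω` is orthogonal to `ΔN(Q′_j)` (tower) then `⟨Δλ, ω̃⟩ = 0` on
`T_η` for EVERY complex `λ` with `Q′_jλ = 0` (split `λ` into real and imaginary parts, each pulled back to the tower).
[cite: Balaban1984PropagatorsI, p.25] -/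
theorem star_LapS_dotProduct_eq_zero (k : ℕ) {ω : Scl (towerM L M k)} (hω : ω ∈ (lapResid L M k)ᗮ)
    {l : Tor (fine (L ^ k) M) → ℂ} (hl : QsOp (L ^ k) M *ᵥ l = 0) :
    star (LapS (fine (L ^ k) M) ((L ^ k : ℕ) : ℂ) *ᵥ l) ⬝ᵥ trS (towerE L M k) (cplxS ω) = 0 := by
  -- real and imaginary parts of `l`, pulled back to the tower, lie in `N(Q′_k)`
  have hre : Qsk L M k (reS L M k l) = 0 := by
    rw [← QsOp_trS_eq_zero_iff, trS_reS, QsOp_mulVec_reC, hl]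
    funext y; simp [reC_apply]
  have him : Qsk L M k (imS L M k l) = 0 := by
    rw [← QsOp_trS_eq_zero_iff, trS_imS, QsOp_mulVec_imC, hl]
    funext y; simp [B5HkOpLandauMin.imC_apply]
  -- each part pairs to zero with `ω`
  have hpart : ∀ {r : Scl (towerM L M k)}, Qsk L M k r = 0 →
      star (LapS (fine (L ^ k) M) ((L ^ k : ℕ) : ℂ) *ᵥ trS (towerE L M k) (cplxS r)) ⬝ᵥ trS (towerE L M k) (cplxS ω) = 0 := by
    intro r hr
    rw [LapS_towerE, star_trS_dotProduct_trS, star_cplxS_dotProduct_cplxS]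
    have hmem : Lap L M k r ∈ lapResid L M k := (mem_lapResid_iff L M k _).2 ⟨r, hr, rfl⟩
    rw [Submodule.inner_right_of_mem_orthogonal hmem hω, Complex.ofReal_zero]
  -- recombine `l = Re l + i Im l`
  have hsplit : l = trS (towerE L M k) (cplxS (reS L M k l)) + Complex.I • trS (towerE L M k) (cplxS (imS L M k l)) := by
    rw [trS_reS, trS_imS, reC_add_imC]
  rw [hsplit, Matrix.mulVec_add, Matrix.mulVec_smul, star_add, star_smul, add_dotProduct, smul_dotProduct,
    hpart hre, hpart him, smul_zero, add_zero]

/-- **`Rproj` IS `RT`** (TW → FN): for every real tower function `ω` on `T_η`, the orthogonal projection onto `ΔN(Q′_j)` (p16's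
`B5Eq147Landau.Rproj`, [B5] p. 25) read on r02's typed torus is the matrix `RT = 1 − PcT − P_const` ((1.69)–(1.70), p21's
`B5Identities197Torus.RT`) applied to `ω` read there. [cite: Balaban1984PropagatorsI, p.25, (1.69)–(1.70) pp.29–30] -/
theorem trS_Rproj (k : ℕ) (ω : Scl (towerM L M k)) :
    trS (towerE L M k) (cplxS (Rproj L M k ω)) = RT (L ^ k) M *ᵥ trS (towerE L M k) (cplxS ω) := by
  set g := trS (towerE L M k) (cplxS ω) with hg
  set v := trS (towerE L M k) (cplxS (Rproj L M k ω)) with hvdef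
  -- (i) `RT` fixes `v`: `v = Δλ̃` with `Q′λ̃ = 0`
  have hmem : Rproj L M k ω ∈ lapResid L M k := Submodule.starProjection_apply_mem _ _
  obtain ⟨l, hl, hleq⟩ := (mem_lapResid_iff L M k _).1 hmem
  have hl' : QsOp (L ^ k) M *ᵥ trS (towerE L M k) (cplxS l) = 0 := (QsOp_trS_eq_zero_iff L M k l).2 hl
  have h1 : RT (L ^ k) M *ᵥ v = v := by
    rw [hvdef, ← hleq, ← LapS_towerE]
    exact RT_mulVec_LapS_of_ker _ _ _ hl'
  -- (ii) `RT` kills `g − v`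
  have h2 : RT (L ^ k) M *ᵥ (g - v) = 0 := by
    have key : ∀ u : Tor (fine (L ^ k) M) → ℂ, star u ⬝ᵥ (RT (L ^ k) M *ᵥ (g - v)) = 0 := by
      intro u
      rw [star_dotProduct_RT_mulVec]
      obtain ⟨l', hl'Q, hl'eq⟩ := RT_mulVec_eq_LapS (L ^ k) M u
      rw [hl'eq, hg, hvdef, ← trS_cplxS_sub]
      exact star_LapS_dotProduct_eq_zero L M k (Submodule.sub_starProjection_mem_orthogonal ω) hl'Q
    funext i
    have h := key (Pi.single i (1 : ℂ) : Tor (fine (L ^ k) M) → ℂ)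
    have hs : star (Pi.single i (1 : ℂ) : Tor (fine (L ^ k) M) → ℂ) = Pi.single i 1 := by
      ext j
      by_cases hij : j = i
      · subst hij; simp
      · simp [hij]
    rwa [hs, single_dotProduct, one_mul] at h
  -- (iii)
  calc trS (towerE L M k) (cplxS (Rproj L M k ω)) = v := rfl
    _ = RT (L ^ k) M *ᵥ v + RT (L ^ k) M *ᵥ (g - v) := by rw [h1, h2, add_zero]
    _ = RT (L ^ k) M *ᵥ g := by rw [← Matrix.mulVec_add, add_sub_cancel]

end TowerToTorus

/-! ## §2  V1 → TW: p21's `RE D c` is the tower projection `Rproj` whenever `N(Q′_D) = N(Q′_j)` -/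

section V1ToTower

variable {P : Params} {j : ℕ} (hj : j ≤ P.m + P.K)

/-- `Δ` with lattice factor `c` is `c²` times `Δ` with factor `1`, on `ℓ²(T_η)`. [cite: Balaban1984PropagatorsII, (2.8) p.224] -/
theorem lapE_eq_smul (c : ℝ) (f : ScalarSpace P) : lapE c f = c ^ 2 • lapE (P := P) 1 f := by
  ext s
  rw [lapE_apply, laplace_eq_smul c, PiLp.smul_apply, lapE_apply, Pi.smul_apply]

/-- hence `ΔN(Q′)` does not depend on the lattice factor: `KE D c = KE D c′` for `c, c′ ≠ 0`. [cite: Balaban1984PropagatorsII, (2.10) p.225] -/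
theorem KE_eq_KE (D : Domains P) {c c' : ℝ} (hc : c ≠ 0) (hc' : c' ≠ 0) : KE D c = KE D c' := by
  have key : ∀ {a b : ℝ}, a ≠ 0 → b ≠ 0 → KE D a ≤ KE D b := by
    intro a b ha hb x hx
    obtain ⟨μ, hμ, rfl⟩ := Submodule.mem_map.1 hx
    refine Submodule.mem_map.2 ⟨(a ^ 2 / b ^ 2) • μ, Submodule.smul_mem _ _ hμ, ?_⟩
    rw [map_smul, lapE_eq_smul b, lapE_eq_smul a, smul_smul]
    congr 1
    field_simp
  exact le_antisymm (key hc hc') (key hc' hc)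

/-- the transport of `Δ` with an arbitrary lattice factor: `tS (Δ^c μ) = (c/L^j)² • Δ (tS μ)` on the tower.
[cite: Balaban1984PropagatorsI, (1.21) p.21] -/
theorem tS_laplace (c : ℝ) (μ : SiteField P 0 ℝ) :
    tS hj (laplace c μ) = (c ^ 2 / ((P.L : ℝ) ^ j) ^ 2) • Lap P.L (Mk P j) j (tS hj μ) := by
  have hL : ((P.L : ℝ) ^ j) ≠ 0 := pow_ne_zero _ (Nat.cast_ne_zero.2 P.L_pos.ne')
  rw [Lap_tS, laplace_eq_smul c, laplace_eq_smul ((P.L : ℝ) ^ j), map_smul, map_smul, smul_smul]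
  congr 1
  field_simp

/-- `Q′_j(tS μ) = 0` on the tower iff `Q′_jμ = 0` on V1 (p16's `Qsk_tS`). [cite: Balaban1984PropagatorsI, (1.20) p.20] -/
theorem Qsk_tS_eq_zero_iff (μ : SiteField P 0 ℝ) :
    Qsk P.L (Mk P j) j (tS hj μ) = 0 ↔ siteAvgIter j μ = 0 := by
  rw [Qsk_tS]
  constructor
  · intro h
    funext y
    have hy := congrArg (fun g => g y) h
    simpa [tSc_apply] using hy
  · intro h
    rw [h]
    ext y
    rw [tSc_apply]
    rfl

/-- the ℓ² pairings agree: `⟨tS f, tS g⟩ = ⟨f, g⟩`. [cite: Balaban1984PropagatorsII, (2.8) p.224] -/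
theorem inner_tS_ofLp (f g : ScalarSpace P) :
    ⟪tS hj (WithLp.ofLp f), tS hj (WithLp.ofLp g)⟫_ℝ = ⟪f, g⟫_ℝ := by
  rw [inner_tS, inner_eq_sum]

/-- **`RE D c` IS `Rproj`** (V1 → TW): if the site constraints of `D` are exactly `Q′_jλ = 0` on `T^{(j)}` then, for every `c ≠ 0`
and every `f ∈ ℓ²(T_η)`, p21's projection `R` of (2.12) transported to the tower is p16's `Rproj` — both are THE orthogonal
projection onto `ΔN(Q′_j)`. [cite: Balaban1984PropagatorsII, (2.10)–(2.12) p.225] -/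
theorem tS_RE (D : Domains P) (hD : ∀ μ : ScalarSpace P, QpE D μ = 0 ↔ siteAvgIter j (WithLp.ofLp μ) = 0)
    {c : ℝ} (hc : c ≠ 0) (f : ScalarSpace P) :
    tS hj (WithLp.ofLp (RE D c f)) = Rproj P.L (Mk P j) j (tS hj (WithLp.ofLp f)) := by
  have hL : ((P.L : ℝ) ^ j) ≠ 0 := pow_ne_zero _ (Nat.cast_ne_zero.2 P.L_pos.ne')
  symm
  apply Submodule.eq_starProjection_of_mem_of_inner_eq_zero
  · -- the image lies in `ΔN(Q′_j)` of the tower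
    have hmem : RE D c f ∈ KE D c := RE_mem D c f
    obtain ⟨μ, hμ, hμeq⟩ := Submodule.mem_map.1 hmem
    have hμ0 : siteAvgIter j (WithLp.ofLp μ) = 0 := (hD μ).1 (LinearMap.mem_ker.1 hμ)
    refine (mem_lapResid_iff P.L (Mk P j) j _).2
      ⟨(c ^ 2 / ((P.L : ℝ) ^ j) ^ 2) • tS hj (WithLp.ofLp μ), ?_, ?_⟩
    · rw [map_smul, (Qsk_tS_eq_zero_iff hj _).2 hμ0, smul_zero]
    · rw [map_smul, ← tS_laplace hj c, ← ofLp_lapE, hμeq]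
  · -- `f − RE f ⊥ ΔN(Q′_j)`
    intro w hw
    obtain ⟨l, hl, rfl⟩ := (mem_lapResid_iff P.L (Mk P j) j _).1 hw
    set μ' : SiteField P 0 ℝ := (tS hj).symm l with hμ'
    have hlμ : l = tS hj μ' := by rw [hμ', LinearEquiv.apply_symm_apply]
    have hμ0 : siteAvgIter j μ' = 0 := (Qsk_tS_eq_zero_iff hj μ').1 (by rw [← hlμ]; exact hl)
    set μ : ScalarSpace P := WithLp.toLp 2 μ' with hμ
    have hμker : μ ∈ LinearMap.ker (QpE D) := LinearMap.mem_ker.2 ((hD μ).2 (by simpa [hμ] using hμ0))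
    -- `Δ^{L^j} μ ∈ KE D c`
    have hKE : lapE ((P.L : ℝ) ^ j) μ ∈ KE D c := by
      rw [KE_eq_KE D hc hL]
      exact Submodule.mem_map.2 ⟨μ, hμker, rfl⟩
    have hlap : Lap P.L (Mk P j) j l = tS hj (WithLp.ofLp (lapE ((P.L : ℝ) ^ j) μ)) := by
      rw [hlμ, Lap_tS, ofLp_lapE]
    rw [hlap, ← map_sub, ← WithLp.ofLp_sub, inner_tS_ofLp]
    exact Submodule.starProjection_inner_eq_zero f _ hKE

/-- **the one-level member of Sect. C** (p. 239: *"only two scales are present now"*, at `Λ′ = ∅`): the site constraints of p22's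
`twoScale j hj ∅` are exactly `Q′_jλ = 0` on `T^{(j)}`. [cite: Balaban1984PropagatorsII, (2.89)–(2.90) p.239 + (2.97) p.240] -/
theorem QpE_twoScale_empty_eq_zero_iff (hj : j + 1 ≤ P.m + P.K) (μ : ScalarSpace P) :
    QpE (twoScale j hj ∅) μ = 0 ↔ siteAvgIter j (WithLp.ofLp μ) = 0 := by
  constructor
  · intro h
    funext y
    have hy : (twoScale j hj (∅ : Finset (Site P (j + 1)))).LamSite ((⟨j, by simp [twoScale.k_eq]⟩ : Fin ((twoScale j hj
        (∅ : Finset (Site P (j + 1)))).k + 1)) : ℕ) y := by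
      show (twoScale j hj (∅ : Finset (Site P (j + 1)))).LamSite j y
      rw [twoScale.lamSite_j]; simp
    have := congrArg (fun g => g ⟨⟨⟨j, by simp [twoScale.k_eq]⟩, y⟩, hy⟩) h
    simpa [QpE_apply] using this
  · intro h
    ext ⟨⟨⟨i, hi⟩, y⟩, hy⟩
    have hij : i = j := by
      by_contra hne
      rcases Nat.lt_or_gt_of_ne hne with hlt | hgt
      · exact twoScale.not_lamSite_of_lt hlt y hy
      · have hik : i ≤ j + 1 := by
          have := hi; simp [twoScale.k_eq] at this; omega
        have hieq : i = j + 1 := by omega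
        subst hieq
        have := (twoScale.lamSite_succ (hj := hj) (Λ' := (∅ : Finset (Site P (j + 1)))) y).1 hy
        simp at this
    subst hij
    have hy0 := congrArg (fun g => g y) h
    simpa [QpE_apply] using hy0

/-- `RE` of the one-level two-scale structure is `Rproj` on the tower. [cite: Balaban1984PropagatorsII, (2.12) p.225 + (2.90) p.239] -/
theorem tS_RE_twoScale_empty (hj : j + 1 ≤ P.m + P.K) {c : ℝ} (hc : c ≠ 0) (f : ScalarSpace P) :
    tS (Nat.le_of_succ_le hj) (WithLp.ofLp (RE (twoScale j hj ∅) c f))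
      = Rproj P.L (Mk P j) j (tS (Nat.le_of_succ_le hj) (WithLp.ofLp f)) :=
  tS_RE _ (twoScale j hj ∅) (QpE_twoScale_empty_eq_zero_iff hj) hc f

end V1ToTower

/-! ## §3  V1 → FN: `R` of (2.12) read on r02's typed torus is `RT` -/

section V1ToTorus

variable {P : Params} {j : ℕ}

/-- **[B6] (2.12) `R` IS [B5] `R = I − P` (one level)**: for every `D` with `N(Q′_D) = N(Q′_j)`, every `c ≠ 0`, every `f`,
`(RE D c f)~ = RT (L^j) (Mk P j) · f̃` on `Tor (fine (L^j) (Mk P j))`, `~` = p16's `tS` followed by p21's `trS (towerE) ∘ cplxS`.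
[cite: Balaban1984PropagatorsII, (2.12) p.225] -/
theorem RE_bridge (hj : j ≤ P.m + P.K) (D : Domains P)
    (hD : ∀ μ : ScalarSpace P, QpE D μ = 0 ↔ siteAvgIter j (WithLp.ofLp μ) = 0) {c : ℝ} (hc : c ≠ 0) (f : ScalarSpace P) :
    trS (towerE P.L (Mk P j) j) (cplxS (tS hj (WithLp.ofLp (RE D c f))))
      = RT (P.L ^ j) (Mk P j) *ᵥ trS (towerE P.L (Mk P j) j) (cplxS (tS hj (WithLp.ofLp f))) := by
  rw [tS_RE hj D hD hc f, trS_Rproj]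

/-- the one-level member of Sect. C (`twoScale j hj ∅`): `R` of (2.90)'s `Δ − ∂P∂* + Q*aQ = ∂*∂ + ∂R∂* + Q*aQ` read on r02's
torus is `RT`. [cite: Balaban1984PropagatorsII, (2.12) p.225 + (2.90) p.239] -/
theorem RE_bridge_twoScale_empty (hj : j + 1 ≤ P.m + P.K) {c : ℝ} (hc : c ≠ 0) (f : ScalarSpace P) :
    trS (towerE P.L (Mk P j) j) (cplxS (tS (Nat.le_of_succ_le hj) (WithLp.ofLp (RE (twoScale j hj ∅) c f))))
      = RT (P.L ^ j) (Mk P j) *ᵥ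
        trS (towerE P.L (Mk P j) j) (cplxS (tS (Nat.le_of_succ_le hj) (WithLp.ofLp f))) :=
  RE_bridge _ (twoScale j hj ∅) (QpE_twoScale_empty_eq_zero_iff hj) hc f

end V1ToTorus

end Literature.MathematicalPhysics.QuantumFieldTheory.Balaban1983to89.B6ProjR212TorusBridge

end
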